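import Summits.QuantumFields.YangMills.Theorems.F4SubCurvatureDoorSubCurvatureKernelSoftAssembly
import Summits.QuantumFields.YangMills.Theorems.F4SubCurvatureDoorSubCurvatureKernelPointwiseRP
import HarnessLib

/-!
# Route `F4SubCurvatureDoor`, crux `SubCurvatureKernel` ⟨stmt-QuantumFields-23036⟩ — the SOFT KERNEL from a continuous representing kernel
# (all six soft clauses of the crux, given (C))

Helper file (`--supports stmt-QuantumFields-23036 --as helper`; free-hands seat `ym-line-frs-p2` g17, soft-half scope).  Definition-free, 0 sorry, standard axioms.
No item is closed; no summit, no crux and no mass gap is proved by this file.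

WHAT.  ★ `softKernel_clauses_of_continuous_kernel`: under `MomentBounds6`, for every off-diagonal limit point `S₁` of an admissible leg scheme and every
measurable REAL kernel `K : ℝ⁴ → ℝ`, CONTINUOUS OFF `0`, with `|K u| ≤ A (1 + ‖u‖⁻¹)⁸` off `0`, representing `S₁ 2` on `⁰𝒮₂`: ALL soft clauses of
`SubCurvatureKernel` hold for `K` verbatim — (1) continuity off `0`, (2) boundedness off the unit ball, (3) W(B₄)-invariance, (4) pointwise reflection
positivity, (6) the representation, (7) King faithfulness — i.e. everything except the SUB-CURVATURE clause (5).  Composition of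
✓`soft_clauses_of_continuous_kernel` and ✓`pointwise_rp_of_offDiagLimitAlong`.  Together with ✓`real_repr_of_offDiagLimitAlong` (a measurable real
kernel with the bound and the representation EXISTS) the soft half of the tenure split (owner ym-idea-3 g23, HOME g23/Sketch23036Split.lean `SoftKernel`)
is reduced to (C): «that kernel has a version continuous off `0`».

HONEST LABEL: the soft half of an OPEN-PROBLEM crux modulo the continuity input (C); the AF sub-curvature clause is untouched; ⟨23036⟩ open; the
Yang–Mills mass gap is NOT proved; no summit is proved by a line.
-/

set_option autoImplicit false

noncomputable section

open scoped SchwartzMap BigOperators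
open MeasureTheory Filter Topology Set
open Literature.MathematicalPhysics.QuantumFieldTheory Literature.MathematicalPhysics.QuantumLattice
open Literature.MathematicalPhysics.AQFT
open Summit.QuantumFields.YangMills.Cruxes.OSLegsFromFemtoAndGap.DlrCollarTransfer (MomentBounds6)
open Summit.QuantumFields.YangMills.Cruxes.OSLegsAtWeakCouplingC.Sketch (IsSignedPerm)
open Summit.QuantumFields.YangMills.Cruxes.OSLegsAtWeakCouplingC.Y2Bridge (King.KingClass)
open Summit.QuantumFields.YangMills.Theorems.ROT (IsLegScheme OffDiagLimitAlong)
open Summit.QuantumFields.YangMills.Theorems.NPointIsotropy.Negative (E4)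
open Summit.QuantumFields.YangMills.Theorems.F4SubCurvatureDoorSubCurvatureKernelSoft (soft_clauses_of_continuous_kernel)
open Summit.QuantumFields.YangMills.Theorems.F4SubCurvatureDoorSubCurvatureKernelPointwiseRP (pointwise_rp_of_offDiagLimitAlong)

namespace Summit.QuantumFields.YangMills.Theorems.F4SubCurvatureDoorSubCurvatureKernelSoftKernel

variable {G : Type} [Group G] [TopologicalSpace G] [IsTopologicalGroup G] [CompactSpace G]
  [MeasurableSpace G] [BorelSpace G]

/-- ★ **THE SOFT KERNEL, GIVEN A CONTINUOUS REPRESENTING KERNEL**: clauses (1)–(4), (6), (7) of `SubCurvatureKernel` for `K`, verbatim.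
[cite: OS1973, §2] [cite: King1986, §2] [cite: OsterwalderSeiler1978, §3] -/
theorem softKernel_clauses_of_continuous_kernel (r : LatticeRep G) {a : ℝ → ℝ} (hapos : ∀ β, 0 < a β)
    (ha0 : Tendsto a atTop (𝓝 0)) (hMB : MomentBounds6 G r a) {sch : SpeciesScheme (YMSpecies G)}
    (hsch : IsLegScheme a sch) {φ : ℕ → ℕ} (hφ : Tendsto φ atTop atTop) {S₁ : SchwingerFamily E4}
    (hS₁ : OffDiagLimitAlong r sch φ S₁) (K : E4 → ℝ) (hKm : Measurable K) (hKc : ContinuousOn K {x : E4 | x ≠ 0})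
    {A : ℝ} (hKb : ∀ u, u ≠ 0 → |K u| ≤ A * (1 + ‖u‖⁻¹) ^ 8)
    (hrep : ∀ F : 𝓢((Fin 2 → E4), ℂ), IsOffDiagonal F →
      Integrable (fun x : Fin 2 → E4 => (K (x 0 - x 1) : ℂ) * F x) ∧ S₁ 2 F = ∫ x : Fin 2 → E4, (K (x 0 - x 1) : ℂ) * F x) :
    ContinuousOn K {x : E4 | x ≠ 0} ∧ (∃ C : ℝ, ∀ x : E4, 1 ≤ ‖x‖ → |K x| ≤ C) ∧
      (∀ R : E4 ≃ₗᵢ[ℝ] E4, IsSignedPerm R → ∀ x : E4, K (R x) = K x) ∧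
      (∀ (m : ℕ) (x : Fin m → E4) (c : Fin m → ℝ), (∀ i, 0 < x i 0) →
        0 ≤ ∑ i, ∑ j, c i * c j * K (timeReflection 4 (x i) - x j)) ∧
      (∀ F : 𝓢((Fin 2 → E4), ℂ), IsOffDiagonal F → HasCompactSupport (F : (Fin 2 → E4) → ℂ) →
        Integrable (fun x : Fin 2 → E4 => (K (x 0 - x 1) : ℂ) * F x) ∧ S₁ 2 F = ∫ x : Fin 2 → E4, (K (x 0 - x 1) : ℂ) * F x) ∧
      (∀ ρ : ℝ, 0 < ρ → ∀ R : E4 ≃ₗᵢ[ℝ] E4,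
        (∀ F ∈ King.KingClass 2 ρ, S₁ 2 (linActMulti R F) = S₁ 2 F) ↔ (∀ x : E4, x ≠ 0 → ‖x‖ < ρ → K (R x) = K x)) := by
  obtain ⟨h1, h2, h3, h6, h7⟩ := soft_clauses_of_continuous_kernel r hapos ha0 hMB hsch hφ hS₁ K hKm hKc hKb hrep
  exact ⟨h1, h2, h3, fun m x c hx => pointwise_rp_of_offDiagLimitAlong r hapos ha0 hMB hsch hφ hS₁ K hKc
    (fun F hF hFc => hrep F hF) m x c hx, h6, h7⟩

end Summit.QuantumFields.YangMills.Theorems.F4SubCurvatureDoorSubCurvatureKernelSoftKernel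

end
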